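import Literature.NumberTheory.Automorphic.KNAQuotientIntegration          -- ★ `anMap`, `exists_measure_quotient_eq_smul_map` (Gelbart 9.22 (iii))
import Literature.NumberTheory.Automorphic.OrbitalMeasureCanonical          -- ★ `compactCore`, `mem_compactCore_iff`
import Mathlib.MeasureTheory.Measure.Haar.Unique
import HarnessLib

/-!
# Torus descent on a product `A × U` with an abelian second factor: the `K T N` data of `A` promoted to `A × U`

Topic `NumberTheory/Automorphic`; namespace `Literature.NumberTheory.Automorphic.TorusDescentProd`.  KERNEL mathematics only: theorems, no definition,
no named fact, no instance, no notation, no `sorry`.  Cell `pub/hodgecm-mathlib`, programme P3a, road «D-N7-inert», brick «(L8b)-H» FILE C′₁ (F0P3b-p01 (g6)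
offer, LEAD F0P3a-plan (g9) T8-28 (2) ∕ T8-33): the GENERIC product plumbing by which the rank-one torus descent of ★ `UnitaryGroupTorusOrbitalDescentNonsplitTwo`
(`A = U(Φ₂)(L⁺_v)`) is read on the endoscopic group `H_v = U(Φ₂)(L⁺_v) × U(Φ₁)(L⁺_v)` (`U = U(Φ₁)(L⁺_v)`, compact abelian) at an element `(t₂, u)` whose
centraliser is `Z = Z_A(t₂) × U = T × U` — the `H`-side of the Levi ∕ split-torus clause of the unit fundamental lemma [Rogawski1990, Prop. 4.9.1 (b)], whose
orbital integrals are over `H_γ \ H` with `H = U(2) × U(1)` treated «uniformly» with `U(3)` [Rogawski1990, p. 98].  HC_CM is proved only modulo the printed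
citations (2 remaining named inputs hLiu418, h413) until rung 0 closes; this file discharges no named fact.

MATHEMATICS (elementary; [Rogawski1990, §4.13 p. 70 «`G = KP`, `P = MU`»], [Gelbart1975, Thm. 9.22 (iii)]).  `A`, `U` topological groups, `T, N, B, K₂ ≤ A` with
`B = T N` (a homeomorphism `T × N ≃ₜ B` in the ★ `anMap` shape), `K₁ ≤ U` with `K₁ = U`, and `Z ≤ A × U` with `z ∈ Z ↔ z.1 ∈ T` (i.e. `Z = T × U`).  Then, on
`A × U` with `N′ := N × 1`, `B′ := B × U`, `K′ := K₂ × K₁`: §1 `Z ≤ B′`, `N′ ≤ B′`, `Z` normalises `N′` (from `T`), good position `m ∈ Z, n ∈ N′, m n ∈ K′ ⇒ m ∈ K′`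
(from `A`), `A × U = K′ B′` (from `A = K₂ B`), `N′` abelian (from `N`); §2 **the homeomorphism `Z × N′ ≃ₜ B′` in the `anMap` shape** (from `T × N ≃ₜ B`);
§3 **the twist on `N′` at `(a, u)` has the module of the twist on `N` at `a`** (every Haar measure of `N′` is the image of one of `N ≅ N′`); §4 `compactCore Z ⊆ K′`
when every compact subgroup of `T` lies in `K₂`.  These are exactly the hypotheses of ★ `KNAQuotientIntegration.exists_measure_quotient_eq_smul_map` and of ★
`TorusOrbitalDescentUnitCanonical` §1 on `G := A × U`, `T := Z`.

References: [Rogawski1990] J. D. Rogawski, *Automorphic Representations of Unitary Groups in Three Variables*, Ann. of Math. Stud. 123 (1990), §4.9 p. 55,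
§4.13 p. 70, p. 98 · [Gelbart1975] S. Gelbart, *Automorphic Forms on Adele Groups*, Ann. of Math. Stud. 83, Thm. 9.22 (iii). -/

set_option autoImplicit false

noncomputable section

open MeasureTheory Measure Set Topology
open scoped ENNReal NNReal

namespace Literature.NumberTheory.Automorphic

namespace TorusDescentProd

/-! ## §1 Subgroup algebra on `A × U` -/

section Algebra

variable {A U : Type*} [Group A] [Group U] {T N B K₂ : Subgroup A} {K₁ : Subgroup U} {Z : Subgroup (A × U)}
  (hZ : ∀ g : A × U, g ∈ Z ↔ g.1 ∈ T)

include hZ in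
/-- `Z ≤ B × U` when `T ≤ B`. [cite: Rogawski1990, §4.13 p. 70] -/
theorem le_prod_top (hTB : T ≤ B) : Z ≤ B.prod (⊤ : Subgroup U) :=
  fun g hg => Subgroup.mem_prod.2 ⟨hTB ((hZ g).1 hg), Subgroup.mem_top _⟩

/-- `N × 1 ≤ B × U` when `N ≤ B`. [cite: Rogawski1990, §4.13 p. 70] -/
theorem prodBot_le_prod_top (hNB : N ≤ B) : N.prod (⊥ : Subgroup U) ≤ B.prod (⊤ : Subgroup U) :=
  Subgroup.prod_mono hNB bot_le

/-- The second component of an element of `N × 1` is `1`. [cite: Rogawski1990, §4.13 p. 70] -/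
theorem snd_eq_one_of_mem_prodBot {n : A × U} (hn : n ∈ N.prod (⊥ : Subgroup U)) : n.2 = 1 :=
  Subgroup.mem_bot.1 (Subgroup.mem_prod.1 hn).2

include hZ in
/-- **`Z = T × U` normalises `N × 1`** when `T` normalises `N`. [cite: Rogawski1990, §1.10 p. 9] -/
theorem conj_mem_prodBot (hTN : ∀ a ∈ T, ∀ n ∈ N, a * n * a⁻¹ ∈ N) :
    ∀ a ∈ Z, ∀ n ∈ N.prod (⊥ : Subgroup U), a * n * a⁻¹ ∈ N.prod (⊥ : Subgroup U) := by
  intro a ha n hn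
  refine Subgroup.mem_prod.2 ⟨hTN a.1 ((hZ a).1 ha) n.1 (Subgroup.mem_prod.1 hn).1, ?_⟩
  rw [Prod.snd_mul, Prod.snd_mul, Prod.snd_inv, snd_eq_one_of_mem_prodBot hn, mul_one, mul_inv_cancel]
  exact Subgroup.one_mem _

include hZ in
/-- **Good position of `K₂ × K₁` with respect to `Z · (N × 1)`** (from that of `K₂` w.r.t. `T · N`, and `K₁ = U`). [cite: Rogawski1990, §4.13 p. 70] -/
theorem mem_prod_of_mul_mem (hKP : ∀ ⦃m u : A⦄, m ∈ T → u ∈ N → m * u ∈ K₂ → m ∈ K₂) (hK₁ : ∀ x : U, x ∈ K₁) :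
    ∀ ⦃m n : A × U⦄, m ∈ Z → n ∈ N.prod (⊥ : Subgroup U) → m * n ∈ K₂.prod K₁ → m ∈ K₂.prod K₁ := by
  intro m n hm hn hmn
  exact Subgroup.mem_prod.2 ⟨hKP ((hZ m).1 hm) (Subgroup.mem_prod.1 hn).1 (Subgroup.mem_prod.1 hmn).1, hK₁ _⟩

/-- **`A × U = (K₂ × K₁) · (B × U)`** from `A = K₂ · B`. [cite: Rogawski1990, §4.13 Lemma 4.13.1 (a) p. 64] -/
theorem exists_mem_prod_mul (hKB : ∀ g : A, ∃ k ∈ K₂, ∃ b ∈ B, g = k * b) :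
    ∀ g : A × U, ∃ k ∈ K₂.prod K₁, ∃ b ∈ B.prod (⊤ : Subgroup U), g = k * b := by
  intro g
  obtain ⟨k, hk, b, hb, hg⟩ := hKB g.1
  refine ⟨(k, 1), Subgroup.mem_prod.2 ⟨hk, Subgroup.one_mem _⟩, (b, g.2), Subgroup.mem_prod.2 ⟨hb, Subgroup.mem_top _⟩, ?_⟩
  exact Prod.ext (by simpa using hg) (by simp)

/-- **`N × 1` is abelian** when `N` is. [cite: Rogawski1990, §1.10 p. 9] -/
theorem mul_comm_prodBot (hN : ∀ x y : ↥N, x * y = y * x) (m m' : ↥(N.prod (⊥ : Subgroup U))) : m * m' = m' * m := by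
  have h1 := congrArg Subtype.val (hN ⟨m.1.1, (Subgroup.mem_prod.1 m.2).1⟩ ⟨m'.1.1, (Subgroup.mem_prod.1 m'.2).1⟩)
  simp only [Subgroup.coe_mul] at h1
  refine Subtype.ext (Prod.ext h1 ?_)
  rw [Subgroup.coe_mul, Subgroup.coe_mul, Prod.snd_mul, Prod.snd_mul, snd_eq_one_of_mem_prodBot m.2, snd_eq_one_of_mem_prodBot m'.2]

include hZ in
/-- **`Z = T × U` is abelian** when `T` and `U` are. [cite: Rogawski1990, §1.10 p. 9] -/
theorem mul_comm_of_mem (hT : ∀ x ∈ T, ∀ y ∈ T, x * y = y * x) (hU : ∀ x y : U, x * y = y * x) :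
    ∀ x ∈ Z, ∀ y ∈ Z, x * y = y * x := fun x hx y hy =>
  Prod.ext (hT x.1 ((hZ x).1 hx) y.1 ((hZ y).1 hy)) (hU x.2 y.2)

end Algebra

/-! ## §2 The homeomorphism `Z × (N × 1) ≃ₜ B × U` in the `anMap` shape -/

section Homeomorph

variable {A U : Type*} [Group A] [Group U] [TopologicalSpace A] [TopologicalSpace U] [IsTopologicalGroup A] [IsTopologicalGroup U]
  {T N B : Subgroup A} (hTB : T ≤ B) (hNB : N ≤ B) {Z : Subgroup (A × U)} (hZ : ∀ g : A × U, g ∈ Z ↔ g.1 ∈ T)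

include hTB hNB hZ in
/-- **THE HOMEOMORPHISM `Z × (N × 1) ≃ₜ B × U`, `(z, n) ↦ z n`** (existence, in the ★ `anMap` shape of Gelbart's `K T N` formula), built from a homeomorphism
`T × N ≃ₜ B` of the same shape: the inverse is `(b, x) ↦ ((τ(b), x), (τ(b)⁻¹ b, 1))` with `(τ(b), τ(b)⁻¹b)` the inverse chart of `A`.
[cite: Rogawski1990, §4.13 p. 70] [cite: Gelbart1975, Thm. 9.22 (iii)] -/
theorem exists_homeomorph_prod_anMap (e₂ : ↥T × ↥N ≃ₜ ↥B) (he₂ : ∀ p, e₂ p = anMap T N B hTB hNB p) :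
    ∃ e : ↥Z × ↥(N.prod (⊥ : Subgroup U)) ≃ₜ ↥(B.prod (⊤ : Subgroup U)),
      ∀ p, e p = anMap Z (N.prod (⊥ : Subgroup U)) (B.prod (⊤ : Subgroup U)) (le_prod_top hZ hTB) (prodBot_le_prod_top hNB) p := by
  -- the `A`-chart read through `e₂`
  have he₂v : ∀ (t : ↥T) (n : ↥N), ((e₂ (t, n) : ↥B) : A) = (t : A) * (n : A) := fun t n => by rw [he₂, coe_anMap]
  have hsymm : ∀ (t : ↥T) (n : ↥N) (h : (t : A) * (n : A) ∈ B), e₂.symm ⟨(t : A) * (n : A), h⟩ = (t, n) := by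
    intro t n h
    rw [Homeomorph.symm_apply_eq]
    exact Subtype.ext (he₂v t n).symm
  have hsymm' : ∀ b : ↥B, (((e₂.symm b).1 : A)) * ((e₂.symm b).2 : A) = (b : A) := by
    intro b
    rw [← he₂v, Prod.mk.eta, Homeomorph.apply_symm_apply]
  -- continuity of the pieces
  have hc1 : Continuous fun b : ↥(B.prod (⊤ : Subgroup U)) => (⟨(b : A × U).1, (Subgroup.mem_prod.1 b.2).1⟩ : ↥B) :=
    (continuous_fst.comp continuous_subtype_val).subtype_mk _
  have hcs : Continuous fun b : ↥(B.prod (⊤ : Subgroup U)) => e₂.symm ⟨(b : A × U).1, (Subgroup.mem_prod.1 b.2).1⟩ := e₂.symm.continuous.comp hc1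
  refine ⟨{ toFun := anMap Z (N.prod (⊥ : Subgroup U)) (B.prod (⊤ : Subgroup U)) (le_prod_top hZ hTB) (prodBot_le_prod_top hNB)
            invFun := fun b =>
              (⟨(((e₂.symm ⟨(b : A × U).1, (Subgroup.mem_prod.1 b.2).1⟩).1 : A), (b : A × U).2),
                  (hZ _).2 (e₂.symm ⟨(b : A × U).1, (Subgroup.mem_prod.1 b.2).1⟩).1.2⟩,
               ⟨(((e₂.symm ⟨(b : A × U).1, (Subgroup.mem_prod.1 b.2).1⟩).2 : A), 1),
                  Subgroup.mem_prod.2 ⟨(e₂.symm ⟨(b : A × U).1, (Subgroup.mem_prod.1 b.2).1⟩).2.2, Subgroup.one_mem _⟩⟩)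
            left_inv := fun p => ?_
            right_inv := fun b => ?_
            continuous_toFun := ((continuous_subtype_val.comp continuous_fst).mul (continuous_subtype_val.comp continuous_snd)).subtype_mk _
            continuous_invFun := ?_ }, fun p => rfl⟩
  · -- left inverse: `(z, n) ↦ z n ↦ ((τ, x), (τ⁻¹ z n, 1))`
    obtain ⟨z, n⟩ := p
    have hn1 : (n : A × U).2 = 1 := snd_eq_one_of_mem_prodBot n.2
    have hval : ((anMap Z (N.prod (⊥ : Subgroup U)) (B.prod (⊤ : Subgroup U)) (le_prod_top hZ hTB) (prodBot_le_prod_top hNB) (z, n) :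
        ↥(B.prod (⊤ : Subgroup U))) : A × U) = ((z : A × U).1 * (n : A × U).1, (z : A × U).2) := by
      rw [coe_anMap]; exact Prod.ext rfl (by rw [Prod.snd_mul, hn1, mul_one])
    have hkey : e₂.symm ⟨((anMap Z (N.prod (⊥ : Subgroup U)) (B.prod (⊤ : Subgroup U)) (le_prod_top hZ hTB) (prodBot_le_prod_top hNB) (z, n) :
        ↥(B.prod (⊤ : Subgroup U))) : A × U).1, (Subgroup.mem_prod.1 (anMap Z (N.prod (⊥ : Subgroup U)) (B.prod (⊤ : Subgroup U))
          (le_prod_top hZ hTB) (prodBot_le_prod_top hNB) (z, n)).2).1⟩ =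
        (⟨(z : A × U).1, (hZ _).1 z.2⟩, ⟨(n : A × U).1, (Subgroup.mem_prod.1 n.2).1⟩) := by
      have h := hsymm ⟨(z : A × U).1, (hZ _).1 z.2⟩ ⟨(n : A × U).1, (Subgroup.mem_prod.1 n.2).1⟩
        (B.mul_mem (hTB ((hZ _).1 z.2)) (hNB (Subgroup.mem_prod.1 n.2).1))
      exact h
    refine Prod.ext (Subtype.ext (Prod.ext ?_ ?_)) (Subtype.ext (Prod.ext ?_ ?_))
    · simp only [hkey]
    · simp only [hval]
    · simp only [hkey]
    · simp only [hn1]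
  · -- right inverse: `(b, x) ↦ ((τ, x), (τ⁻¹b, 1)) ↦ (τ τ⁻¹ b, x 1) = (b, x)`
    refine Subtype.ext (Prod.ext ?_ ?_)
    · rw [coe_anMap, Prod.fst_mul]
      exact hsymm' _
    · rw [coe_anMap, Prod.snd_mul]
      exact mul_one _
  · -- continuity of the inverse
    refine Continuous.prodMk ?_ ?_
    · exact (((continuous_subtype_val.comp (continuous_fst.comp hcs)).prodMk (continuous_snd.comp continuous_subtype_val))).subtype_mk _
    · exact (((continuous_subtype_val.comp (continuous_snd.comp hcs)).prodMk continuous_const)).subtype_mk _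

end Homeomorph

/-! ## §3 The twist on `N × 1` at `(a, u)` -/

section Twist

variable {A U : Type*} [Group A] [Group U] [TopologicalSpace A] [TopologicalSpace U] [IsTopologicalGroup A] [IsTopologicalGroup U]
  [MeasurableSpace A] [BorelSpace A] [MeasurableSpace (A × U)] [BorelSpace (A × U)] {N : Subgroup A}

/-- **The twist property transports from `N` to `N × 1`**: if `∫_N Φ₂(n a n⁻¹) dμ₂ = J ∫_N Φ₂(a n) dμ₂` for EVERY Haar measure `μ₂` of `N` and every measurable
`Φ₂ ≥ 0` on `A`, then `∫_{N×1} Φ(n (a,u) n⁻¹) dμ = J ∫_{N×1} Φ((a,u) n) dμ` for every Haar measure `μ` of `N × 1` and every measurable `Φ ≥ 0` on `A × U`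
(`N ≅ N × 1` is a topological isomorphism; `n (a, u) n⁻¹ = (n₁ a n₁⁻¹, u)`). [cite: Rogawski1990, §4.9 p. 55] -/
theorem lintegral_conj_prodBot_eq_mul (a : A) (u : U) {J : ℝ≥0∞}
    (hJac₂ : ∀ (μ₂ : Measure ↥N) [IsHaarMeasure μ₂] (Φ₂ : A → ℝ≥0∞), Measurable Φ₂ →
      ∫⁻ n, Φ₂ ((n : A) * a * (n : A)⁻¹) ∂μ₂ = J * ∫⁻ n, Φ₂ (a * (n : A)) ∂μ₂)
    (μN : Measure ↥(N.prod (⊥ : Subgroup U))) [IsHaarMeasure μN] (Φ : A × U → ℝ≥0∞) (hΦ : Measurable Φ) :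
    ∫⁻ n, Φ ((n : A × U) * (a, u) * (n : A × U)⁻¹) ∂μN = J * ∫⁻ n, Φ ((a, u) * (n : A × U)) ∂μN := by
  -- `N ≅ N × 1`
  let eN : ↥N ≃ₜ* ↥(N.prod (⊥ : Subgroup U)) :=
    { toFun := fun n => ⟨((n : A), 1), Subgroup.mem_prod.2 ⟨n.2, Subgroup.one_mem _⟩⟩
      invFun := fun m => ⟨(m : A × U).1, (Subgroup.mem_prod.1 m.2).1⟩
      left_inv := fun n => rfl
      right_inv := fun m => Subtype.ext (Prod.ext rfl (snd_eq_one_of_mem_prodBot m.2).symm)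
      map_mul' := fun n n' => Subtype.ext (Prod.ext rfl (mul_one _).symm)
      continuous_toFun := ((continuous_subtype_val.prodMk continuous_const)).subtype_mk _
      continuous_invFun := (continuous_fst.comp continuous_subtype_val).subtype_mk _ }
  haveI : IsHaarMeasure (μN.map eN.symm) := ContinuousMulEquiv.isHaarMeasure_map μN eN.symm
  have hΦ₂ : Measurable fun x : A => Φ (x, u) := hΦ.comp (continuous_id.prodMk continuous_const).measurable
  have h := hJac₂ (μN.map eN.symm) (fun x => Φ (x, u)) hΦ₂
  have hme : MeasurableEmbedding (eN.symm : ↥(N.prod (⊥ : Subgroup U)) → ↥N) := eN.symm.toHomeomorph.measurableEmbedding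
  rw [hme.lintegral_map, hme.lintegral_map] at h
  have h1 : ∀ n : ↥(N.prod (⊥ : Subgroup U)), Φ (((eN.symm n : ↥N) : A) * a * ((eN.symm n : ↥N) : A)⁻¹, u) =
      Φ ((n : A × U) * (a, u) * (n : A × U)⁻¹) := fun n => by
    congr 1
    refine Prod.ext rfl ?_
    change u = (n : A × U).2 * u * ((n : A × U)⁻¹).2
    rw [Prod.snd_inv, snd_eq_one_of_mem_prodBot n.2, one_mul, inv_one, mul_one]
  have h2 : ∀ n : ↥(N.prod (⊥ : Subgroup U)), Φ (a * ((eN.symm n : ↥N) : A), u) = Φ ((a, u) * (n : A × U)) := fun n => by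
    congr 1
    refine Prod.ext rfl ?_
    change u = u * (n : A × U).2
    rw [snd_eq_one_of_mem_prodBot n.2, mul_one]
  simp_rw [h1, h2] at h
  exact h

end Twist

/-! ## §4 The compact core of `Z = T × U` lies in `K₂ × K₁` -/

section Core

variable {A U : Type*} [Group A] [Group U] [TopologicalSpace A] [TopologicalSpace U]
  {T K₂ : Subgroup A} {K₁ : Subgroup U} {Z : Subgroup (A × U)} (hZ : ∀ g : A × U, g ∈ Z ↔ g.1 ∈ T)

include hZ in
/-- **`compactCore Z ⊆ K₂ × K₁`** when every compact subgroup of `T` lies in `K₂` and `K₁ = U`: a compact subgroup of `Z = T × U` projects to a compact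
subgroup of `T`. [cite: Rogawski1990, §4.3 p. 43] -/
theorem compactCore_subset_preimage_prod (hint : ∀ C : Subgroup A, IsCompact (C : Set A) → C ≤ T → C ≤ K₂) (hK₁ : ∀ x : U, x ∈ K₁) :
    compactCore ↥Z ⊆ Subtype.val ⁻¹' ((K₂.prod K₁ : Subgroup (A × U)) : Set (A × U)) := by
  intro z hz
  obtain ⟨C₀, hC₀, hzC₀⟩ := (mem_compactCore_iff z).1 hz
  let π : ↥Z →* A := (MonoidHom.fst A U).comp Z.subtype
  have hπ : Continuous π := continuous_fst.comp continuous_subtype_val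
  have hC : IsCompact ((C₀.map π : Subgroup A) : Set A) := by rw [Subgroup.coe_map]; exact hC₀.image hπ
  have hCT : C₀.map π ≤ T := by
    rintro _ ⟨c, -, rfl⟩
    exact (hZ (c : A × U)).1 c.2
  refine Subgroup.mem_prod.2 ⟨hint _ hC hCT ⟨z, hzC₀, rfl⟩, hK₁ _⟩

end Core

end TorusDescentProd

end Literature.NumberTheory.Automorphic

end
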